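import Summits.AtomisticToContinuum.HydrodynamicLimit.Theorems.MourreKoopmanChargesStressStrongMixingLowDensityGibbsUniqueness3Lipschitz
import Literature.MathematicalPhysics.StatisticalMechanics.LowActivityHardSphereGibbsUniqueness
import Literature.MathematicalPhysics.KineticTheory.HardSphereGibbsGNZIdentity
import Literature.MathematicalPhysics.KineticTheory.FluctuationSpace
import HarnessLib

/-!
# `StressStrongMixing` · line `birth`: stub `stub_lowDensityGibbsUniqueness3`
# (low-density uniqueness of the translation-invariant unit-diameter hard-sphere DLR state in `ℝ³`)

Closes the registered stub `stub_lowDensityGibbsUniqueness3` of the skeleton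
`Cruxes/StressStrongMixing/Lines/birth.lean` (crux item stmt-AtomisticToContinuum-9584, route `MourreKoopmanCharges` of
`AtomisticToContinuum/HydrodynamicLimit`): there is `ρ₀ > 0` (here `ρ₀ = 1/2000`) such that two translation-invariant
DLR states `G, G'` of the unit-diameter hard-sphere gas in `ℝ³` with centred Maxwellian marks of the same inverse
temperature `β > 0`, activities `z, z' > 0`, and the SAME DENSITY `< ρ₀` coincide.  This is the `d = 3`, `ε = 1`,
`u = 0` instance of the tree's named fact `HardSphereGibbsLowDensityUniqueness` (Ruelle 1969 Thm 4.2.3 with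
Georgii 1995 Rem. 3.7), now PROVED from tree theorems:

1. GNZ sandwich (`HardSphereDLR.activity_le_two_mul_density`): density `ρ < 1/2000` forces `z, z' ≤ 2ρ < 1/1000`;
2. equal activities ⇒ equal states (`IsHardSphereGibbs.unique_of_small_activity`, `16 z < 1`, Michelen–Perkins);
3. different activities are impossible: by the one-point GNZ identity `ρ = z · G(V)` (`V` = no centre in the exclusion
   ball `B(0,1)`, `HardSphereDLR.density_eq_activity_mul_measure_ball_empty`), `z q = z' q'` with `q' ≥ 1/2`, so for
   `z < z'` one gets `z (q - q') = (z' - z) q' ≥ (z' - z)/2`; but the vacancy probability is `432`-Lipschitz in the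
   activity (`abs_measureReal_vacancy_sub_le`, infrastructure files `…Cloud`, `…Estimates`, `…Lipschitz`), whence
   `(z' - z)/2 ≤ 432 z (z' - z) < (z' - z)/2` — the injectivity of `z ↦ ρ(z)` on `(0, 1/1000)`.

References: D. Ruelle, *Statistical Mechanics: Rigorous Results* (1969), Thm 4.2.3 and §4.3; H.-O. Georgii,
*The equivalence of ensembles for classical systems of particles*, J. Stat. Phys. 80 (1995), Thm 3.4, Rem. 3.7;
D. Dereudre, LNM 2237 (2019), Prop. 10; M. Michelen, W. Perkins, arXiv:2109.01094, Thm 3.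
-/

noncomputable section

open MeasureTheory ProbabilityTheory Filter Topology
open scoped ENNReal

namespace Summit.AtomisticToContinuum.HydrodynamicLimit.Theorems.MourreKoopmanChargesStressStrongMixing

open Literature.MathematicalPhysics.KineticTheory Literature.Analysis.FluidPDE
open Literature.MathematicalPhysics.StatisticalMechanics

/-- **The ordered case**: two translation-invariant unit-diameter hard-sphere DLR states in `ℝ³` with activities
`0 < z ≤ z'`, the same `β > 0`, and the same density `< 1/2000` are equal. -/
theorem hardSphereGibbs_eq_of_density_eq_of_le {β z z' : ℝ} {G G' : Measure MarkedConfig} (hβ : 0 < β)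
    (hz : 0 < z) (hz' : 0 < z') (hzz' : z ≤ z') (hG : IsHardSphereGibbs 1 z β (0 : V3) G)
    (hG' : IsHardSphereGibbs 1 z' β (0 : V3) G') (hti : IsTranslationInvariant G) (hti' : IsTranslationInvariant G')
    (hd : PointProcess.density G = PointProcess.density G')
    (hlt : PointProcess.density G < ENNReal.ofReal (1 / 2000)) : G = G' := by
  haveI := hG.1
  haveI := hG'.1
  -- the common density as a real number
  set ρ : ℝ := (PointProcess.density G).toReal with hρdef
  have hρtop : PointProcess.density G ≠ ∞ := hlt.ne_top
  have hρE : PointProcess.density G = ENNReal.ofReal ρ := (ENNReal.ofReal_toReal hρtop).symm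
  have hρE' : PointProcess.density G' = ENNReal.ofReal ρ := hd ▸ hρE
  have hρ0 : 0 ≤ ρ := ENNReal.toReal_nonneg
  have hρlt : ρ < 1 / 2000 := (ENNReal.ofReal_lt_ofReal_iff (by norm_num)).1 (hρE ▸ hlt)
  -- small density forces small activities (GNZ sandwich with `n = 2`)
  have h8 : ((2 ^ Fintype.card (Fin 3) : ℕ) : ℝ) * ρ ≤ 1 / 2 := by
    rw [Fintype.card_fin]; norm_num; linarith
  have hn : 2 * (1 : ℝ) ≤ ((2 : ℕ) : ℝ) := by norm_num
  have hz2 : z ≤ 2 * ρ := HardSphereDLR.activity_le_two_mul_density hG hti hz.le hβ hn hρE hρ0 h8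
  have hz'2 : z' ≤ 2 * ρ := HardSphereDLR.activity_le_two_mul_density hG' hti' hz'.le hβ hn hρE' hρ0 h8
  have hz'96 : z' ≤ 1 / 96 := by linarith
  rcases hzz'.eq_or_lt with heq | hlt'
  · -- equal activities: uniqueness at small activity
    subst heq
    exact hG.unique_of_small_activity one_pos hz.le (by nlinarith) hβ hG'
  · -- different activities contradict the Lipschitz bound on the vacancy probability
    exfalso
    have hδ : 0 < z' - z := sub_pos.2 hlt'
    set q : ℝ := G.real {X : MarkedConfig | X.count (Metric.ball (0 : V3) 1 ×ˢ (Set.univ : Set V3)) = 0} with hqdef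
    set q' : ℝ := G'.real {X : MarkedConfig | X.count (Metric.ball (0 : V3) 1 ×ˢ (Set.univ : Set V3)) = 0} with hq'def
    have hq'0 : 0 ≤ q' := measureReal_nonneg
    -- GNZ: `z q = z' q'` and `ρ = z' q'`
    have hzq : z * q = z' * q' := by
      have h := congrArg ENNReal.toReal
        (HardSphereDLR.activity_mul_measure_ball_empty_eq_of_density_eq hG hG' hti hti' hz.le hz'.le hβ hd)
      rwa [ENNReal.toReal_mul, ENNReal.toReal_mul, ENNReal.toReal_ofReal hz.le, ENNReal.toReal_ofReal hz'.le,
        ← measureReal_def, ← measureReal_def] at h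
    have hρq' : ρ = z' * q' := by
      have h := congrArg ENNReal.toReal (HardSphereDLR.density_eq_activity_mul_measure_ball_empty hG' hti' hz'.le hβ)
      rwa [hρE', ENNReal.toReal_ofReal hρ0, ENNReal.toReal_mul, ENNReal.toReal_ofReal hz'.le, ← measureReal_def] at h
    have hρpos : 0 < ρ := by linarith
    have hq'half : 1 / 2 ≤ q' := by
      have h1 : ρ * 1 ≤ ρ * (2 * q') := by nlinarith [mul_le_mul_of_nonneg_right hz'2 hq'0]
      have h2 := le_of_mul_le_mul_left h1 hρpos
      linarith
    -- the Lipschitz bound (Poisson-form DLR class, mark law `M_β`)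
    have hL : |q' - q| ≤ 432 * (z' - z) := by
      have hμ := isHsLocalGibbs_of_isHardSphereGibbs (0 : V3) hz.le hβ hG
      have hμ' := isHsLocalGibbs_of_isHardSphereGibbs (0 : V3) hz'.le hβ hG'
      haveI := isProbabilityMeasure_withDensity_maxwellianBeta hβ (0 : V3)
      exact abs_measureReal_vacancy_sub_le _ hz.le hzz' hz'96 hμ hμ'
    have h1 : z * (q - q') = (z' - z) * q' := by linear_combination hzq
    have h2 : q - q' ≤ 432 * (z' - z) := by
      rw [abs_sub_comm] at hL
      exact (le_abs_self _).trans hL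
    have h3 : (z' - z) * q' ≤ z * (432 * (z' - z)) := by
      rw [← h1]
      exact mul_le_mul_of_nonneg_left h2 hz.le
    have hz1000 : z < 1 / 1000 := by linarith
    nlinarith [mul_le_mul_of_nonneg_left hq'half hδ.le, mul_lt_mul_of_pos_right hz1000 (by positivity : (0 : ℝ) < 432 * (z' - z))]

/-- **STUB `stub_lowDensityGibbsUniqueness3` (registered, line `birth` of crux stmt-AtomisticToContinuum-9584)**:
low-density uniqueness of the translation-invariant unit-diameter hard-sphere DLR state in `ℝ³` with centred Maxwellian
marks — two such states with the same inverse temperature and the same density `< ρ₀ = 1/2000` are equal, whatever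
their activities (`= LowDensityGibbsUniqueness3` of the skeleton; the `d = 3` instance of the named fact
`HardSphereGibbsLowDensityUniqueness`). -/
theorem stub_lowDensityGibbsUniqueness3 :
    ∃ ρ₀ : ℝ, 0 < ρ₀ ∧ ∀ (β z z' : ℝ) (G G' : Measure MarkedConfig), 0 < β → 0 < z → 0 < z' →
      IsHardSphereGibbs 1 z β (0 : V3) G → IsHardSphereGibbs 1 z' β (0 : V3) G' →
      IsTranslationInvariant G → IsTranslationInvariant G' →
      PointProcess.density G = PointProcess.density G' → PointProcess.density G < ENNReal.ofReal ρ₀ → G = G' := by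
  refine ⟨1 / 2000, by norm_num, ?_⟩
  intro β z z' G G' hβ hz hz' hG hG' hti hti' hd hlt
  rcases le_total z z' with h | h
  · exact hardSphereGibbs_eq_of_density_eq_of_le hβ hz hz' h hG hG' hti hti' hd hlt
  · exact (hardSphereGibbs_eq_of_density_eq_of_le hβ hz' hz h hG' hG hti' hti hd.symm (hd ▸ hlt)).symm

end Summit.AtomisticToContinuum.HydrodynamicLimit.Theorems.MourreKoopmanChargesStressStrongMixing

end
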